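import Summits.PneNP.PneNP.Theorems.SingleThreshold.Negative.Independence
import Literature.Computability.Complexity.RossmanMonotoneCliqueGraphs
import Literature.Computability.Complexity.NegationElimination

/-!
# The noisy-planted advantage of a circuit is at most `(#edges it reads) · (k/n)²`

Route `OneSlice`, crux `Summit.PneNP.PneNP.Theses.OneSlice.SingleThreshold` (stmt-PneNP-2833), line
`two-round-exposure` (lead c3): the registered calibration stub `stub_advLeReads` (stub M) — the three
open needles `stub_descentSplit` ⊇ `stub_relativeSparseDose`, `stub_noisyIndistSparse` at SMALL sizes.

**What.** For any background law `G(n,q)` (`0 ≤ q ≤ 1`), any `2 ≤ k ≤ n`, `0 < n`, and any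
circuit `D` of fan-in `≤ 2` on the edges of `K_n` (no monotonicity needed):
`E_{S,A}[D(S ∪ K_A)] − Pr_S[D(S) = 1] ≤ (2·|D| + 1) · (k/n)²` (`adv_le_reads`), where `S ∼ G(n,q)`
and `A` is a uniform `k`-set. Hence NoisyIndist (in each of its three registered costumes) holds
for circuits of size `≤ n^c` with `c < 2` by locality alone, and the first contentful exponent of
the needle is `c = 2` (as the crux's is `c = 2` after the shift `c ↦ c + 1` of the two-round
transfer; cf. `Negative/Locality.lean`, which is the analogous statement for the error at the
critical density).

**How.** `D(S ∪ K_A) ≠ D(S)` forces the two inputs to differ on an edge READ by `D`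
(`eval_congr`), i.e. some read edge `e` lies in `K_A` (both endpoints in `A`); for each of the
`≤ 2|D| + 1` read edges (`length_inputList_le`) this has probability `≤ (k/n)²` over `A`
(`kSubsetProb_supset_le` with `#(endpts e) = 2`); union bound over the list, then average over `S`.

## References

* B. Rossman, *The monotone complexity of k-clique on random graphs*, FOCS 2010 / SIAM J. Comput.
  43 (2014), §9 (the single-threshold problem) [Rossman2010]; the locality observation is folklore.
-/

noncomputable section

set_option linter.dupNamespace false

open Finset

open scoped Classical

namespace Summit.PneNP.PneNP.Theorems.SingleThreshold

open Literature.Computability.Complexity GateList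
open Summit.PneNP.PneNP.Theorems.SingleThreshold.Negative (Edges inputList eval_congr length_inputList_le)

variable {n : ℕ}

/-- Union bound for the uniform `k`-set over a list of events. [folklore] -/
theorem kSubsetProb_exists_mem_list_le {k : ℕ} {α : Type*} (L : List α)
    (P : α → Finset (Fin n) → Prop) [∀ a, DecidablePred (P a)] {b : ℝ}
    (hb : ∀ a ∈ L, kSubsetProb n k (P a) ≤ b) :
    kSubsetProb n k (fun A => ∃ a ∈ L, P a A) ≤ L.length * b := by
  induction L with
  | nil =>
    have : kSubsetProb n k (fun A => ∃ a ∈ ([] : List α), P a A) ≤ 0 := by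
      unfold kSubsetProb
      rw [filter_false_of_mem (fun A _ => by simp), card_empty, Nat.cast_zero, zero_div]
    simpa using this
  | cons a L ih =>
    have h1 := kSubsetProb_le_add (n := n) (k := k) (fun A => ∃ a' ∈ a :: L, P a' A) (P a)
    have h1' : kSubsetProb n k (fun A => (∃ a' ∈ a :: L, P a' A) ∧ ¬ P a A) ≤
        kSubsetProb n k (fun A => ∃ a' ∈ L, P a' A) := by
      refine kSubsetProb_mono ?_
      rintro A ⟨⟨a', ha', hP⟩, hnot⟩
      rcases List.mem_cons.1 ha' with rfl | h
      · exact absurd hP hnot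
      · exact ⟨a', h, hP⟩
    have h2 := ih fun a' ha' => hb a' (List.mem_cons_of_mem _ ha')
    have h3 := hb a List.mem_cons_self
    simp only [List.length_cons, Nat.cast_add, Nat.cast_one]
    linarith

/-- A read edge lies inside the random `k`-set with probability `≤ (k/n)²`. [folklore] -/
theorem kSubsetProb_cliqueVec_true_le {k : ℕ} (hkn : k ≤ n) (hn : 0 < n) (hk : 2 ≤ k) (e : Edges n) :
    kSubsetProb n k (fun A => cliqueVec A e = true) ≤ ((k : ℝ) / n) ^ 2 := by
  have h := kSubsetProb_supset_le hkn hn (endpts e) (by rw [card_endpts]; exact hk)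
  rw [card_endpts] at h
  exact le_trans (kSubsetProb_mono fun A hA => (cliqueVec_eq_true_iff_endpts A e).1 hA) h

/-- **Planting changes the value only through a read edge**: if `D (x ⊔ K_A) ≠ D x` then some edge
read by `D` has both endpoints in `A`. [folklore] -/
theorem exists_read_of_eval_sup_ne (D : Circuit (Edges n)) (x : Edges n → Bool) (A : Finset (Fin n))
    (h : D.eval (x ⊔ cliqueVec A) ≠ D.eval x) : ∃ e ∈ inputList D, cliqueVec A e = true := by
  by_contra hc
  push Not at hc
  refine h (eval_congr D fun e he => ?_)
  have : cliqueVec A e = false := by simpa using hc e he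
  simp [this]

/-- Pointwise in the background: `Pr_A[D(x ∪ K_A) = 1] − [D x = 1] ≤ (2|D|+1)(k/n)²`. [folklore] -/
theorem kSubsetProb_eval_sup_sub_le {k : ℕ} (hkn : k ≤ n) (hn : 0 < n) (hk : 2 ≤ k)
    (D : Circuit (Edges n)) (hD : ∀ g ∈ D.gates, g.arity ≤ 2) (x : Edges n → Bool) :
    kSubsetProb n k (fun A => D.eval (x ⊔ cliqueVec A) = true) -
        (if D.eval x = true then (1 : ℝ) else 0) ≤ (2 * D.size + 1) * ((k : ℝ) / n) ^ 2 := by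
  have hkn0 : 0 ≤ ((k : ℝ) / n) ^ 2 := by positivity
  by_cases hx : D.eval x = true
  · rw [if_pos hx]
    have h1 := kSubsetProb_le_one n k (fun A => D.eval (x ⊔ cliqueVec A) = true)
    have h2 : (0 : ℝ) ≤ (2 * D.size + 1) * ((k : ℝ) / n) ^ 2 := by positivity
    linarith
  · rw [if_neg hx, sub_zero]
    have h1 : kSubsetProb n k (fun A => D.eval (x ⊔ cliqueVec A) = true) ≤
        kSubsetProb n k (fun A => ∃ e ∈ inputList D, cliqueVec A e = true) := by
      refine kSubsetProb_mono fun A hA => exists_read_of_eval_sup_ne D x A ?_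
      rw [hA]
      exact fun h' => hx h'.symm
    have h2 : kSubsetProb n k (fun A => ∃ e ∈ inputList D, cliqueVec A e = true) ≤
        (inputList D).length * ((k : ℝ) / n) ^ 2 :=
      kSubsetProb_exists_mem_list_le (inputList D) (fun e A => cliqueVec A e = true)
        (fun e _ => kSubsetProb_cliqueVec_true_le hkn hn hk e)
    have h3 : ((inputList D).length : ℝ) ≤ 2 * D.size + 1 := by
      exact_mod_cast length_inputList_le D hD
    have h4 := mul_le_mul_of_nonneg_right h3 hkn0
    linarith

/-- **The noisy-planted advantage is at most `(2|D| + 1)(k/n)²`** for every fan-in-`2` circuit `D`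
and every background density `q ∈ [0,1]` (see the module docstring). [folklore] -/
theorem adv_le_reads {k : ℕ} (hkn : k ≤ n) (hn : 0 < n) (hk : 2 ≤ k) {q : ℝ} (hq0 : 0 ≤ q)
    (hq1 : q ≤ 1) (D : Circuit (Edges n)) (hD : ∀ g ∈ D.gates, g.arity ≤ 2) :
    (∑ x : Edges n → Bool, gnpWeight n q x *
        kSubsetProb n k (fun A => D.eval (x ⊔ cliqueVec A) = true)) -
      gnpProb n q (univ.filter fun x => D.eval x = true) ≤
    (2 * D.size + 1) * ((k : ℝ) / n) ^ 2 := by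
  have hsum : gnpProb n q (univ.filter fun x => D.eval x = true) =
      ∑ x : Edges n → Bool, gnpWeight n q x * (if D.eval x = true then (1 : ℝ) else 0) := by
    rw [gnpProb_filter]
    refine sum_congr rfl fun x _ => ?_
    split_ifs <;> simp
  have hone : (∑ x : Edges n → Bool, gnpWeight n q x) = 1 := gnpProb_univ n q
  rw [hsum, ← sum_sub_distrib]
  calc ∑ x : Edges n → Bool, (gnpWeight n q x * kSubsetProb n k (fun A => D.eval (x ⊔ cliqueVec A) = true) -
          gnpWeight n q x * (if D.eval x = true then (1 : ℝ) else 0))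
      ≤ ∑ x : Edges n → Bool, gnpWeight n q x * ((2 * D.size + 1) * ((k : ℝ) / n) ^ 2) := by
        refine sum_le_sum fun x _ => ?_
        rw [← mul_sub]
        exact mul_le_mul_of_nonneg_left (kSubsetProb_eval_sup_sub_le hkn hn hk D hD x)
          (gnpWeight_nonneg hq0 hq1 x)
    _ = (2 * D.size + 1) * ((k : ℝ) / n) ^ 2 := by rw [← sum_mul, hone, one_mul]

/-- Fan-in over `{∧₂, ∨₂, 0, 1}` is at most `2`. [folklore] -/
theorem arity_le_two_of_isOver01 {ι : Type*} {C : Circuit ι} (hC : C.IsOver monotoneBasis01) :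
    ∀ g ∈ C.gates, g.arity ≤ 2 := by
  intro g hg
  have h := hC g hg
  simp only [monotoneBasis01, monotoneBasis, Set.mem_insert_iff, Set.mem_singleton_iff] at h
  rcases h with h | h | h | h
  · have := congrArg Sigma.fst h
    simp only [Gate.fn, GateFn.const] at this
    omega
  · have := congrArg Sigma.fst h
    simp only [Gate.fn, GateFn.const] at this
    omega
  · have := congrArg Sigma.fst h
    simp only [Gate.fn, GateFn.and] at this
    omega
  · have := congrArg Sigma.fst h
    simp only [Gate.fn, GateFn.or] at this
    omega

/-- **The needles hold below `n²` gates** (calibration): for `k ≥ 2` and EVERY exponent pair with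
`size·k² = o(n²)` — here in the concrete form used by the skeleton: monotone `{∧₂,∨₂,0,1}`-circuits of
size `≤ s` have noisy-planted advantage `≤ (2s+1)(k/n)²` at every background density. [folklore] -/
theorem adv_le_of_size_le {k s : ℕ} (hkn : k ≤ n) (hn : 0 < n) (hk : 2 ≤ k) {q : ℝ} (hq0 : 0 ≤ q)
    (hq1 : q ≤ 1) (D : Circuit (Edges n)) (hD : D.IsOver monotoneBasis01) (hs : D.size ≤ s) :
    (∑ x : Edges n → Bool, gnpWeight n q x *
        kSubsetProb n k (fun A => D.eval (x ⊔ cliqueVec A) = true)) -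
      gnpProb n q (univ.filter fun x => D.eval x = true) ≤
    (2 * s + 1) * ((k : ℝ) / n) ^ 2 := by
  refine (adv_le_reads hkn hn hk hq0 hq1 D (arity_le_two_of_isOver01 hD)).trans ?_
  have : (2 * (D.size : ℝ) + 1) ≤ 2 * s + 1 := by
    have : (D.size : ℝ) ≤ s := by exact_mod_cast hs
    linarith
  exact mul_le_mul_of_nonneg_right this (by positivity)

/-- **Stub M of line `two-round-exposure` (registered `stub_advLeReads`): the needles hold below
`n²` gates.** For `2 ≤ k ≤ n`, `0 < n`, every background density `q ∈ [0,1]` and every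
`{∧₂,∨₂,0,1}`-circuit `D` of size `≤ s`: `E_{S,A}[D(S ∪ K_A)] − Pr_S[D(S)=1] ≤ (2s+1)(k/n)²`
(`adv_le_of_size_le` in closed form). [folklore] -/
theorem stub_advLeReads :
    ∀ (n k s : ℕ), k ≤ n → 0 < n → 2 ≤ k → ∀ q : ℝ, 0 ≤ q → q ≤ 1 →
      ∀ D : Circuit (Edges n), D.IsOver monotoneBasis01 → D.size ≤ s →
        (∑ x : Edges n → Bool, gnpWeight n q x *
            kSubsetProb n k (fun A => D.eval (x ⊔ cliqueVec A) = true)) -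
          gnpProb n q (univ.filter fun x => D.eval x = true) ≤ (2 * s + 1) * ((k : ℝ) / n) ^ 2 :=
  fun _ _ _ hkn hn hk _ hq0 hq1 D hD hs => adv_le_of_size_le hkn hn hk hq0 hq1 D hD hs

end Summit.PneNP.PneNP.Theorems.SingleThreshold

end
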